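import Summits.ValiantsHypothesis.ValiantsHypothesis.Theorems.SymPencilEquivariantSdcNotQPPermEmbeddingOfYoungFixedVector
import HarnessLib

/-!
# ValiantsHypothesis — the equivariant dial: THRESHOLD PERMIFY, file 1/5 — the irreducible
# retract (D) at an ARBITRARY Young fixed-vector index budget `B`

Helper of `stmt-ValiantsHypothesis-23702` (`--as helper`; 0 definitions, 0 named facts, closes NO
item).  Decomposition workshop VALIANT, lens-1 («representation-theoretic obstruction splitting»),
g36, offer O-L1-28 «THRESHOLD PERMIFY».

The tree's permify chain `stub_permify ⇐ (iii′) ⇐ (iii″) ⇐ (D) ⇐ (H2)`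
(`…SymPencilEquivariantSdcNotQPPermEmbeddingOfYoungFixedVector.lean`,
`…PermEmbeddingOfIrreducible.lean`) hard-wires the quasi-polynomial index budget
`2^{(log₂ k + log₂ n + c)^c}` of the Young fixed-vector hypothesis (H2) into `∃ d`-packaged
conclusions.  The ONLY super-polynomial cost of the chain is that budget; everything else is
bookkeeping.  This file transcribes the irreducible step (D) — `permEmbeddingD_of_youngFixedVector`
— with the budget abstracted to a parameter `B`:

* **`retractD_of_budget`**: for a finite group `G ↠ 𝔖_n × 𝔖_n` (kernel acting by scalars `c`,
  `c^M = 1`) and an irreducible `ρ : G →* GL_k ℂ`, `k ≤ M`, IF every representation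
  `𝔄_n × 𝔄_n →* GL_k ℂ` has a nonzero functional fixed by a subgroup of index `≤ B`, THEN either
  `n ≤ 4 (log₂ M + 1)` (the small regime of Schur's spin dichotomy `spinDichotomy_symmetric`, returned
  as a disjunct instead of being retracted through `ker ρ`) or `ρ` is a retract of a permutation
  representation of degree `≤ 4 M B` (`permRetract_frobenius` through `Y.comap ψ ⊓ ker θ` for the
  twisted representation `θ⁻¹ρ` on `φ⁻¹(𝔄_n × 𝔄_n)`, perfectness of `𝔄_n × 𝔄_n`, `n ≥ 5`).

The proof text is the tree's (val-lit-p6 g12 / g14), with the two marked changes; it is a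
TRANSCRIPTION, not new mathematics.  The new input of O-L1-28 (the threshold Young dichotomy that
feeds `B = (n+1)^{2τ}`) is in `…EquivariantDialThresholdYoung.lean`; the rate consequences in
`…EquivariantDialThresholdPermify.lean` / `…EquivariantDialNearExponentialHeads.lean`.

HONEST BOUNDARY: 0 S-currency; closes NO item; infrastructure only (no dial claim in this file);
`stmt-23702` / `VP ≠ VNP` untouched.
-/

noncomputable section

set_option linter.dupNamespace false

namespace Summit.ValiantsHypothesis.ValiantsHypothesis.Theorems.EquivariantDialThresholdPermify

open Matrix
open Summit.ValiantsHypothesis.ValiantsHypothesis.Theorems.SymPencilEquivariantSdcNotQP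
open Summit.ValiantsHypothesis.ValiantsHypothesis.Theorems.SymPencilEquivariantSdcNotQP.YoungBounds
open Summit.ValiantsHypothesis.ValiantsHypothesis.Theorems.SymPencilEquivariantSdcNotQP.SpinDichotomy

/-- **(D) at budget `B`.**  Transcription of `permEmbeddingD_of_youngFixedVector` with the Young
fixed-vector budget a parameter `B` and the small regime `n ≤ 4 (log₂ k + 1)` of
`spinDichotomy_symmetric` returned as the left disjunct (`log₂ k ≤ log₂ M`).  Main regime verbatim:
`G₀ = φ⁻¹(𝔄_n × 𝔄_n)` of index `≤ 4`, spin character `θ` on `G₀` with `θ^M = 1` on `ker ψ`, hence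
`[G₀ : ker θ] ≤ M` by perfectness (`n ≥ 5`); the twisted representation `θ⁻¹ρ|_{G₀}` descends to
`σA : 𝔄_n × 𝔄_n →* GL_k ℂ`; the budget hypothesis gives `Y` of index `≤ B` fixing `ℓ ≠ 0`;
`L = (Y.comap ψ ⊓ ker θ) ≤ G` fixes `ℓ` for `ρ` and has index `≤ B · M · 4`; `permRetract_frobenius`.
[folklore; transcription] -/
theorem retractD_of_budget (n M k B : ℕ) (G : Type) [Group G] [Finite G]
    (φ : G →* Equiv.Perm (Fin n) × Equiv.Perm (Fin n)) (ρ : G →* GL (Fin k) ℂ)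
    (hφ : Function.Surjective φ)
    (hker : ∀ g : G, φ g = 1 → ∃ c : ℂ, c ^ M = 1 ∧
      (ρ g : Matrix (Fin k) (Fin k) ℂ) = c • (1 : Matrix (Fin k) (Fin k) ℂ))
    (hkM : k ≤ M)
    (hirr : ∀ W : Submodule ℂ (Fin k → ℂ),
      (∀ g : G, W ≤ W.comap (Matrix.toLin' (ρ g : Matrix (Fin k) (Fin k) ℂ))) → W = ⊥ ∨ W = ⊤)
    (hY : 1 ≤ k → ∀ σ : ↥(alternatingGroup (Fin n)) × ↥(alternatingGroup (Fin n)) →* GL (Fin k) ℂ,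
      ∃ Y : Subgroup (↥(alternatingGroup (Fin n)) × ↥(alternatingGroup (Fin n))),
        Y.index ≤ B ∧ ∃ ℓ : (Fin k → ℂ) →ₗ[ℂ] ℂ, ℓ ≠ 0 ∧
          ∀ y ∈ Y, ℓ ∘ₗ Matrix.toLin' (σ y : Matrix (Fin k) (Fin k) ℂ) = ℓ) :
    n ≤ 4 * (Nat.log 2 M + 1) ∨ ∃ m' ≤ 4 * M * B,
      ∃ (ι : Matrix (Fin m') (Fin k) ℂ) (p : Matrix (Fin k) (Fin m') ℂ) (τ : G → Equiv.Perm (Fin m')),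
        p * ι = 1 ∧ ∀ g : G,
          (τ g).permMatrix ℂ * ι = ι * (ρ g : Matrix (Fin k) (Fin k) ℂ) ∧
          p * (τ g).permMatrix ℂ = (ρ g : Matrix (Fin k) (Fin k) ℂ) * p := by
  classical
  -- `k = 0`: everything is a `Fin 0`-indexed matrix
  rcases Nat.eq_zero_or_pos k with hk0 | hk
  · subst hk0
    refine Or.inr ⟨0, Nat.zero_le _, 0, 0, fun _ => 1, ?_, fun g => ⟨?_, ?_⟩⟩
    · ext i; exact Fin.elim0 i
    · ext i; exact Fin.elim0 i
    · ext i; exact Fin.elim0 i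
  have hM : M ≠ 0 := by omega
  -- CHANGE (a): the small regime is the left disjunct
  have small : n ≤ 4 * (Nat.log 2 k + 1) → n ≤ 4 * (Nat.log 2 M + 1) := fun hn =>
    hn.trans (Nat.mul_le_mul_left _ (Nat.succ_le_succ (Nat.log_mono_right hkM)))
  -- common end of the main regime: a subgroup fixing a nonzero functional, of index within budget
  have finish : ∀ (L : Subgroup G) (ℓ : (Fin k → ℂ) →ₗ[ℂ] ℂ), ℓ ≠ 0 →
      (∀ l ∈ L, ℓ ∘ₗ Matrix.toLin' (ρ l : Matrix (Fin k) (Fin k) ℂ) = ℓ) → L.index ≤ 4 * M * B →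
      ∃ m' ≤ 4 * M * B,
        ∃ (ι : Matrix (Fin m') (Fin k) ℂ) (p : Matrix (Fin k) (Fin m') ℂ) (τ : G → Equiv.Perm (Fin m')),
          p * ι = 1 ∧ ∀ g : G,
            (τ g).permMatrix ℂ * ι = ι * (ρ g : Matrix (Fin k) (Fin k) ℂ) ∧
            p * (τ g).permMatrix ℂ = (ρ g : Matrix (Fin k) (Fin k) ℂ) * p := by
    intro L ℓ hℓ0 hℓL hidx
    obtain ⟨m', ι, p, τ, hm', hpι, hrel⟩ := permRetract_frobenius G L k ρ ℓ hirr hℓ0 hℓL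
    exact ⟨m', hm' ▸ hidx, ι, p, τ, hpι, hrel⟩
  -- tiny `n`: small regime
  by_cases hn4 : n ≤ 4
  · refine Or.inl (small (hn4.trans ?_))
    exact Nat.le_mul_of_pos_right _ (Nat.succ_pos _)
  have hn5 : 5 ≤ n := by omega
  -- the index-`≤ 4` subgroup `G₀ = φ⁻¹(𝔄_n × 𝔄_n)` and `ψ : G₀ ↠ 𝔄_n × 𝔄_n`
  set AA : Subgroup (Equiv.Perm (Fin n) × Equiv.Perm (Fin n)) :=
    (alternatingGroup (Fin n)).prod (alternatingGroup (Fin n)) with hAA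
  set G₀ : Subgroup G := AA.comap φ with hG₀
  have hG₀idx : G₀.index ≤ 4 := by
    rw [hG₀, Subgroup.index_comap_of_surjective _ hφ]
    exact index_alternating_prod_le n
  let ψ₀ : G₀ →* AA := (φ.comp G₀.subtype).codRestrict AA (fun g => g.2)
  let ψ : G₀ →* ↥(alternatingGroup (Fin n)) × ↥(alternatingGroup (Fin n)) :=
    (Subgroup.prodEquiv (alternatingGroup (Fin n)) (alternatingGroup (Fin n))).toMonoidHom.comp ψ₀
  have hψ_surj : Function.Surjective ψ := by
    intro x
    obtain ⟨y, hy⟩ :=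
      (Subgroup.prodEquiv (alternatingGroup (Fin n)) (alternatingGroup (Fin n))).surjective x
    obtain ⟨g, hg⟩ := hφ (y : Equiv.Perm (Fin n) × Equiv.Perm (Fin n))
    have hgmem : g ∈ G₀ := by rw [hG₀, Subgroup.mem_comap, hg]; exact y.2
    refine ⟨⟨g, hgmem⟩, ?_⟩
    rw [← hy]
    change (Subgroup.prodEquiv _ _) (ψ₀ ⟨g, hgmem⟩) = _
    congr 1
    apply Subtype.ext
    change φ g = y
    exact hg
  have hψ_ker : ∀ g : G₀, ψ g = 1 ↔ φ (g : G) = 1 := by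
    intro g
    change (Subgroup.prodEquiv _ _) (ψ₀ g) = 1 ↔ _
    rw [MulEquiv.map_eq_one_iff, ← OneMemClass.coe_eq_one]
    exact Iff.rfl
  -- the restricted representation
  let σ : G₀ →* GL (Fin k) ℂ := ρ.comp G₀.subtype
  have hσ : ∀ g : G₀, σ g = ρ (g : G) := fun g => rfl
  -- Schur's spin dichotomy (PROVED in the tree): small regime, or a spin character `θ`
  have hker' : ∀ g : G, φ g = 1 → ∃ c : ℂ,
      (ρ g : Matrix (Fin k) (Fin k) ℂ) = c • (1 : Matrix (Fin k) (Fin k) ℂ) := by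
    intro g hg
    obtain ⟨c', -, hc'⟩ := hker g hg
    exact ⟨c', hc'⟩
  rcases spinDichotomy_symmetric φ ρ hφ hker' with hsmall | ⟨θ, hθ'⟩
  · exact Or.inl (small hsmall)
  have hθ : ∀ g : G₀, ψ g = 1 →
      (σ g : Matrix (Fin k) (Fin k) ℂ) = ((θ g : ℂˣ) : ℂ) • (1 : Matrix (Fin k) (Fin k) ℂ) :=
    fun g hg => hθ' g ((hψ_ker g).mp hg)
  -- `θ` has order dividing `M` on `ker ψ`, hence `[G₀ : ker θ] ≤ M` by perfectness
  have hθM : ∀ g : G₀, ψ g = 1 → θ g ^ M = 1 := by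
    intro g hg
    obtain ⟨c', hc'M, hc'⟩ := hker g ((hψ_ker g).mp hg)
    have e : ((θ g : ℂˣ) : ℂ) = c' :=
      (scalar_eq_apply ⟨0, hk⟩ (hθ g hg)).trans (scalar_eq_apply ⟨0, hk⟩ hc').symm
    apply Units.ext
    rw [Units.val_pow_eq_pow_val, e, hc'M, Units.val_one]
  have hθidx : θ.ker.index ≤ M :=
    index_ker_le_of_sup_eq_top ψ θ
      (ker_sup_ker_eq_top_of_perfect (commutator_alternating_prod_eq_top n hn5) ψ hψ_surj θ) M hM hθM
  -- the twisted representation `σ' = θ⁻¹ σ`, trivial on `ker ψ`, and its descent to `𝔄_n × 𝔄_n`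
  let σ' : G₀ →* GL (Fin k) ℂ :=
    { toFun := fun g => ⟨((θ g)⁻¹ : ℂˣ).val • (σ g : Matrix (Fin k) (Fin k) ℂ),
        (θ g : ℂˣ).val • ((σ g)⁻¹ : GL (Fin k) ℂ).val, by
          rw [Matrix.smul_mul, Matrix.mul_smul, smul_smul, Units.mul_inv, Units.inv_mul, one_smul], by
          rw [Matrix.smul_mul, Matrix.mul_smul, smul_smul, Units.inv_mul, Units.mul_inv, one_smul]⟩
      map_one' := by
        apply Units.ext
        simp only [map_one, inv_one, Units.val_one, one_smul]
      map_mul' := fun x y => by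
        apply Units.ext
        simp only [map_mul, mul_inv, Units.val_mul, Matrix.smul_mul, Matrix.mul_smul, smul_smul]
        rw [mul_comm] }
  have hσ' : ∀ g, (σ' g : Matrix (Fin k) (Fin k) ℂ) =
      ((θ g)⁻¹ : ℂˣ).val • (σ g : Matrix (Fin k) (Fin k) ℂ) := fun g => rfl
  have hσ'ker : ψ.ker ≤ σ'.ker := by
    intro g hg
    rw [MonoidHom.mem_ker] at hg ⊢
    apply Units.ext
    rw [hσ', hθ g hg, smul_smul, Units.inv_mul, one_smul, Units.val_one]
  obtain ⟨σA, hσA⟩ : ∃ σA : (↥(alternatingGroup (Fin n)) × ↥(alternatingGroup (Fin n))) →* GL (Fin k) ℂ,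
      ∀ g, σA (ψ g) = σ' g :=
    ⟨ψ.liftOfRightInverse (Function.surjInv hψ_surj) (Function.rightInverse_surjInv hψ_surj) ⟨σ', hσ'ker⟩,
      fun g => MonoidHom.liftOfRightInverse_comp_apply ψ (Function.surjInv hψ_surj)
        (Function.rightInverse_surjInv hψ_surj) ⟨σ', hσ'ker⟩ g⟩
  -- CHANGE (b): the Young fixed vector for the descended representation comes from the budget `B`
  obtain ⟨Y, hYidx, ℓ, hℓ0, hℓY⟩ := hY hk σA
  -- the subgroup `L = (Y.comap ψ ⊓ ker θ) ≤ G₀ ≤ G` fixes `ℓ`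
  set L : Subgroup G := (Y.comap ψ ⊓ θ.ker).map G₀.subtype with hL
  refine Or.inr (finish L ℓ hℓ0 ?_ ?_)
  · intro l hl
    obtain ⟨g, hg, rfl⟩ := Subgroup.mem_map.mp hl
    obtain ⟨hgY, hgθ⟩ := Subgroup.mem_inf.mp hg
    rw [Subgroup.mem_comap] at hgY
    rw [MonoidHom.mem_ker] at hgθ
    have e : (ρ (G₀.subtype g) : Matrix (Fin k) (Fin k) ℂ) = (σA (ψ g) : Matrix (Fin k) (Fin k) ℂ) := by
      rw [hσA, hσ', hgθ, inv_one, Units.val_one, one_smul, hσ, Subgroup.coe_subtype]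
    rw [e]
    exact hℓY _ hgY
  · have h1 : L.index = (Y.comap ψ ⊓ θ.ker).index * G₀.index := Subgroup.index_map_subtype _
    have h2 : (Y.comap ψ ⊓ θ.ker).index ≤ (Y.comap ψ).index * θ.ker.index := Subgroup.index_inf_le
    have h3 : (Y.comap ψ).index = Y.index := Subgroup.index_comap_of_surjective _ hψ_surj
    calc L.index ≤ (Y.comap ψ).index * θ.ker.index * G₀.index := by
          rw [h1]; exact Nat.mul_le_mul_right _ h2
      _ ≤ B * M * 4 := by
          rw [h3]; exact Nat.mul_le_mul (Nat.mul_le_mul hYidx hθidx) hG₀idx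
      _ = 4 * M * B := by ring

end Summit.ValiantsHypothesis.ValiantsHypothesis.Theorems.EquivariantDialThresholdPermify

end
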